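import Mathlib
import HarnessLib

/-!
# Double points of perturbed cusps, II: the model map and its zeros

Second file of the flat-model proof of D. McDuff's theorem that `C¹`-small `J`-holomorphic
immersed perturbations of a cuspidal `J`-holomorphic disc have double points (McDuff, J.
Differential Geom. 34 (1991), Thm 1.4 with Cor. 4.4 and (5.6); see the header of
`JHolomorphicCuspDoublePointsDesign.lean` for the plan). In the critical chart the cusp is
`F(w) = (wᵏ, û(w))` with `û(μ w) - û(w) ~ C_μ w^{m_μ}` for the `k`-th roots of unity `μ ≠ 1`
(Wendl, *Lectures on Contact 3-Manifolds, Holomorphic Curves and Intersection Theory* (2020),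
Thm B.23), and the degree count is carried out on an explicit **model map**

  `Φ(z, w) = (zᵏ - wᵏ, Q(z, w) - ε e₂(w))`,

where `Q` is the holomorphic polynomial interpolating the branch differences (`Q(z, μz) = -C_μ
z^{m_μ}`, `Q(z, z) = 0`; `interpolant_line`, `interpolant_diag`) and `e₂` is the planar field of the
design lemma. This file computes, by pure algebra and calculus:

* `model_package` — in the bidisc `‖(z, w)‖ < s` the zeros of `Φ` are EXACTLY the diagonal points
  `(w, w)` at the designed zeros of `e₂` and the points `(z, μ z)` with `z^{m_μ} = -ε / C_μ`
  (`m_μ` of them on each branch); `Φ` is differentiable at every zero with non-degenerate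
  Jacobian, POSITIVE at the branch zeros (there `Φ` is holomorphic: real determinant
  `= |det_ℂ|²`, `det_restrictScalars_pos_of`, the complex determinant being read off from one row
  and one column, `det_prod_self_of_apply_one`) and of the sign of `N` at the diagonal zeros
  (`det_of_diag_shape`: a shear of determinant one and a block-triangular determinant,
  `det_of_fst_apply_inr_eq_zero` / `det_of_snd_apply_inl_eq_zero`); hence the signed count of the
  zeros is `Σ_μ m_μ + N`.

Everything is proved; there are no definitions and no named facts.

## References

* D. McDuff, *The local behaviour of holomorphic curves in almost complex 4-manifolds*,
  J. Differential Geom. 34 (1991) 143–164, Thm 1.4, Cor. 4.4, (5.6). [McDuff1991LocalBehaviour]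
* J. Milnor, *Topology from the Differentiable Viewpoint* (1965), §6 (Lemma 4: the index at a
  non-degenerate zero is the sign of the Jacobian). [MilnorTDV1965]
* C. Wendl, *Lectures on Contact 3-Manifolds, Holomorphic Curves and Intersection Theory*,
  Cambridge Tracts in Math. 220 (2020), Thm B.23. [Wendl2020]
-/

noncomputable section

open scoped Real ComplexConjugate Topology
open Complex Set Filter Metric

namespace Literature.Geometry.Symplectic

namespace CuspDoublePoints

/-! ### Linear algebra: `2 × 2` and block determinants -/

section LinAlg

variable {R : Type*} [CommRing R]

/-- The determinant of an endomorphism of `R × R` in the standard basis. [folklore] -/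
theorem det_prod_self (L : (R × R) →ₗ[R] (R × R)) :
    LinearMap.det L = (L (1, 0)).1 * (L (0, 1)).2 - (L (0, 1)).1 * (L (1, 0)).2 := by
  rw [← LinearMap.det_toMatrix (Module.Basis.finTwoProd R), Matrix.det_fin_two]
  simp [LinearMap.toMatrix_apply, Module.Basis.coe_finTwoProd_repr, Module.Basis.finTwoProd_zero,
    Module.Basis.finTwoProd_one]

/-- The `−bβ` trick: if an endomorphism `L` of `R × R` kills the first coordinate of `(1, μ)`,
`(L (1, μ)).1 = 0`, then `det L = -(L (0, 1)).1 · (L (1, μ)).2`. [folklore] -/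
theorem det_prod_self_of_apply_one (L : (R × R) →ₗ[R] (R × R)) (μ : R)
    (h : (L (1, μ)).1 = 0) : LinearMap.det L = -((L (0, 1)).1 * (L (1, μ)).2) := by
  have hsplit : L (1, μ) = L (1, 0) + μ • L (0, 1) := by
    rw [← map_smul, ← map_add]; simp
  rw [det_prod_self]
  rw [hsplit] at h ⊢
  simp only [Prod.fst_add, Prod.smul_fst, smul_eq_mul, Prod.snd_add, Prod.smul_snd] at h ⊢
  linear_combination (L (0, 1)).2 * h

variable {M N : Type*} [AddCommGroup M] [Module R M] [AddCommGroup N] [Module R N]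
  [Module.Free R M] [Module.Finite R M] [Module.Free R N] [Module.Finite R N]

/-- **Block lower-triangular determinant.** If the upper-right block of an endomorphism `L` of
`M × N` vanishes (`(L (0, y)).1 = 0`), then `det L = det L₁₁ · det L₂₂`. [folklore] -/
theorem det_of_fst_apply_inr_eq_zero (L : (M × N) →ₗ[R] (M × N)) (h : ∀ y, (L (0, y)).1 = 0) :
    LinearMap.det L = LinearMap.det ((LinearMap.fst R M N) ∘ₗ L ∘ₗ (LinearMap.inl R M N)) *
      LinearMap.det ((LinearMap.snd R M N) ∘ₗ L ∘ₗ (LinearMap.inr R M N)) := by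
  classical
  let bM := Module.Free.chooseBasis R M
  let bN := Module.Free.chooseBasis R N
  have hmat : LinearMap.toMatrix (bM.prod bN) (bM.prod bN) L =
      Matrix.fromBlocks (LinearMap.toMatrix bM bM ((LinearMap.fst R M N) ∘ₗ L ∘ₗ (LinearMap.inl R M N)))
        0 (LinearMap.toMatrix bM bN ((LinearMap.snd R M N) ∘ₗ L ∘ₗ (LinearMap.inl R M N)))
        (LinearMap.toMatrix bN bN ((LinearMap.snd R M N) ∘ₗ L ∘ₗ (LinearMap.inr R M N))) := by
    ext i j
    rcases i with i | i <;> rcases j with j | j <;>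
      simp [LinearMap.toMatrix_apply, Module.Basis.prod_apply, Module.Basis.prod_repr_inl,
        Module.Basis.prod_repr_inr, h]
  rw [← LinearMap.det_toMatrix (bM.prod bN), hmat, Matrix.det_fromBlocks_zero₁₂,
    LinearMap.det_toMatrix, LinearMap.det_toMatrix]

/-- **Block upper-triangular determinant.** If the lower-left block of an endomorphism `L` of
`M × N` vanishes (`(L (x, 0)).2 = 0`), then `det L = det L₁₁ · det L₂₂`. [folklore] -/
theorem det_of_snd_apply_inl_eq_zero (L : (M × N) →ₗ[R] (M × N)) (h : ∀ x, (L (x, 0)).2 = 0) :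
    LinearMap.det L = LinearMap.det ((LinearMap.fst R M N) ∘ₗ L ∘ₗ (LinearMap.inl R M N)) *
      LinearMap.det ((LinearMap.snd R M N) ∘ₗ L ∘ₗ (LinearMap.inr R M N)) := by
  classical
  let bM := Module.Free.chooseBasis R M
  let bN := Module.Free.chooseBasis R N
  have hmat : LinearMap.toMatrix (bM.prod bN) (bM.prod bN) L =
      Matrix.fromBlocks (LinearMap.toMatrix bM bM ((LinearMap.fst R M N) ∘ₗ L ∘ₗ (LinearMap.inl R M N)))
        (LinearMap.toMatrix bN bM ((LinearMap.fst R M N) ∘ₗ L ∘ₗ (LinearMap.inr R M N))) 0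
        (LinearMap.toMatrix bN bN ((LinearMap.snd R M N) ∘ₗ L ∘ₗ (LinearMap.inr R M N))) := by
    ext i j
    rcases i with i | i <;> rcases j with j | j <;>
      simp [LinearMap.toMatrix_apply, Module.Basis.prod_apply, Module.Basis.prod_repr_inl,
        Module.Basis.prod_repr_inr, h]
  rw [← LinearMap.det_toMatrix (bM.prod bN), hmat, Matrix.det_fromBlocks_zero₂₁,
    LinearMap.det_toMatrix, LinearMap.det_toMatrix]

end LinAlg

/-- The real determinant of multiplication by `u` on `ℂ` is `|u|²`. [folklore] -/
theorem det_mul_restrictScalars (u : ℂ) :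
    LinearMap.det ((LinearMap.mul ℂ ℂ u).restrictScalars ℝ) = normSq u := by
  rw [LinearMap.det_restrictScalars, Algebra.norm_complex_apply]
  congr 1
  have : LinearMap.mul ℂ ℂ u = u • LinearMap.id := by ext; simp
  rw [this, LinearMap.det_smul, LinearMap.det_id, mul_one, Module.finrank_self, pow_one]

/-- The real determinant of a complex-linear endomorphism of `ℂ × ℂ` is `|det_ℂ|²`. [folklore] -/
theorem det_restrictScalars_prod (L : (ℂ × ℂ) →ₗ[ℂ] (ℂ × ℂ)) :
    LinearMap.det (L.restrictScalars ℝ) = normSq (LinearMap.det L) := by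
  rw [LinearMap.det_restrictScalars, Algebra.norm_complex_apply]

/-! ### The interpolating polynomial `Q` -/

section Poly

variable {k : ℕ} {C : ℂ → ℂ} {m : ℂ → ℕ}

/-- On the line `w = μ z` (`μ` a `k`-th root of unity other than `1`) the interpolant equals
`-C_μ z^{m_μ}`. [folklore] -/
theorem interpolant_line (hk : 0 < k)
    (hm : ∀ μ ∈ (Polynomial.nthRootsFinset k (1 : ℂ)).erase 1, k - 1 ≤ m μ)
    {μ : ℂ} (hμ : μ ∈ (Polynomial.nthRootsFinset k (1 : ℂ)).erase 1) (z : ℂ) :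
    (∑ μ' ∈ (Polynomial.nthRootsFinset k (1 : ℂ)).erase 1,
      -C μ' * z ^ (m μ' - (k - 1)) *
        ∏ ν ∈ (Polynomial.nthRootsFinset k (1 : ℂ)).erase μ', (μ * z - ν * z) / (μ' - ν)) =
      -C μ * z ^ m μ := by
  classical
  set Rk := Polynomial.nthRootsFinset k (1 : ℂ) with hRk
  have hμR : μ ∈ Rk := Finset.mem_of_mem_erase hμ
  rw [Finset.sum_eq_single μ]
  · -- the `μ`-term
    have hprod : ∏ ν ∈ Rk.erase μ, (μ * z - ν * z) / (μ - ν) = z ^ (k - 1) := by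
      have : ∀ ν ∈ Rk.erase μ, (μ * z - ν * z) / (μ - ν) = z := by
        intro ν hν
        have hne : μ - ν ≠ 0 := sub_ne_zero.2 (Finset.ne_of_mem_erase hν).symm
        field_simp
      rw [Finset.prod_congr rfl this, Finset.prod_const, Finset.card_erase_of_mem hμR,
        (Complex.isPrimitiveRoot_exp k hk.ne').card_nthRootsFinset]
    rw [hprod, mul_assoc, ← pow_add, Nat.sub_add_cancel (hm μ hμ)]
  · -- the other terms vanish
    intro μ' hμ' hne
    apply mul_eq_zero_of_right
    apply Finset.prod_eq_zero (i := μ) (Finset.mem_erase.2 ⟨hne.symm, hμR⟩)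
    simp
  · intro h; exact absurd hμ h

/-- On the diagonal `w = z` the interpolant vanishes. [folklore] -/
theorem interpolant_diag (z : ℂ) :
    (∑ μ' ∈ (Polynomial.nthRootsFinset k (1 : ℂ)).erase 1,
      -C μ' * z ^ (m μ' - (k - 1)) *
        ∏ ν ∈ (Polynomial.nthRootsFinset k (1 : ℂ)).erase μ', (z - ν * z) / (μ' - ν)) = 0 := by
  classical
  refine Finset.sum_eq_zero fun μ' hμ' => ?_
  rcases Nat.eq_zero_or_pos k with hk | hk
  · subst hk; simp [Polynomial.nthRootsFinset_zero] at hμ'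
  apply mul_eq_zero_of_right
  have h1 : (1 : ℂ) ∈ (Polynomial.nthRootsFinset k (1 : ℂ)).erase μ' :=
    Finset.mem_erase.2 ⟨(Finset.ne_of_mem_erase hμ').symm,
      (Polynomial.mem_nthRootsFinset hk (1 : ℂ)).2 (one_pow k)⟩
  exact Finset.prod_eq_zero h1 (by simp)

/-- The interpolant, as a function of the pair `(z, w)`, is complex differentiable. [folklore] -/
theorem differentiable_interpolant :
    Differentiable ℂ fun p : ℂ × ℂ => ∑ μ' ∈ (Polynomial.nthRootsFinset k (1 : ℂ)).erase 1,
      -C μ' * p.1 ^ (m μ' - (k - 1)) *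
        ∏ ν ∈ (Polynomial.nthRootsFinset k (1 : ℂ)).erase μ', (p.2 - ν * p.1) / (μ' - ν) := by
  classical
  refine Differentiable.fun_sum fun μ' _ => ?_
  refine (Differentiable.mul (differentiable_const _) (differentiable_fst.pow _)).mul ?_
  intro p
  have : ∀ ν ∈ (Polynomial.nthRootsFinset k (1 : ℂ)).erase μ',
      HasFDerivAt (fun p : ℂ × ℂ => (p.2 - ν * p.1) / (μ' - ν))
        (fderiv ℂ (fun p : ℂ × ℂ => (p.2 - ν * p.1) / (μ' - ν)) p) p := by
    intro ν _
    refine DifferentiableAt.hasFDerivAt ?_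
    have heq : (fun p : ℂ × ℂ => (p.2 - ν * p.1) / (μ' - ν)) =
        fun p : ℂ × ℂ => (p.2 - ν * p.1) * (μ' - ν)⁻¹ := by
      funext p; rw [div_eq_mul_inv]
    rw [heq]
    exact ((differentiableAt_snd.sub (differentiableAt_fst.const_mul _)).mul_const _)
  exact (HasFDerivAt.finsetProd this).differentiableAt

end Poly

/-! ### Roots of `zⁿ = c` -/

/-- `zⁿ = rⁿ` (`r ≠ 0`, `n ≥ 1`) iff `z = r ζ` for an `n`-th root of unity `ζ`. [folklore] -/
theorem pow_eq_pow_iff_exists_root' {n : ℕ} (hn : 0 < n) {r : ℂ} (hr : r ≠ 0) (z : ℂ) :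
    z ^ n = r ^ n ↔ ∃ ζ ∈ Polynomial.nthRootsFinset n (1 : ℂ), z = r * ζ := by
  constructor
  · intro h
    refine ⟨z / r, (Polynomial.mem_nthRootsFinset hn (1 : ℂ)).2 ?_, by field_simp⟩
    rw [div_pow, h, div_self (pow_ne_zero _ hr)]
  · rintro ⟨ζ, hζ, rfl⟩
    rw [mul_pow, (Polynomial.mem_nthRootsFinset hn (1 : ℂ)).1 hζ, mul_one]

/-! ### Calculus of the two components -/

/-- The derivative of `(z, w) ↦ zᵏ - wᵏ`. [folklore] -/
theorem hasFDerivAt_pow_sub_pow (k : ℕ) (p : ℂ × ℂ) :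
    HasFDerivAt (fun q : ℂ × ℂ => q.1 ^ k - q.2 ^ k)
      (((k : ℂ) * p.1 ^ (k - 1)) • ContinuousLinearMap.fst ℂ ℂ ℂ -
        ((k : ℂ) * p.2 ^ (k - 1)) • ContinuousLinearMap.snd ℂ ℂ ℂ) p := by
  have h1 := (hasDerivAt_pow k p.1).comp_hasFDerivAt p (hasFDerivAt_fst (𝕜 := ℂ) (F := ℂ))
  have h2 := (hasDerivAt_pow k p.2).comp_hasFDerivAt p (hasFDerivAt_snd (𝕜 := ℂ) (E := ℂ))
  exact (h1.sub h2).congr_of_eventuallyEq (Eventually.of_forall fun q => rfl)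

/-- Directional derivative of a differentiable `Q` along the line `t ↦ (t, μ t)` on which
`Q (t, μ t) = c tⁿ`. [folklore] -/
theorem fderiv_apply_one_mu {Q : ℂ × ℂ → ℂ} (hQ : Differentiable ℂ Q) {μ c : ℂ} {n : ℕ}
    (hline : ∀ t : ℂ, Q (t, μ * t) = c * t ^ n) (z : ℂ) :
    fderiv ℂ Q (z, μ * z) (1, μ) = c * (n * z ^ (n - 1)) := by
  have hι : HasDerivAt (fun t : ℂ => (t, μ * t)) (1, μ) z := by
    have := (hasDerivAt_id z).prodMk ((hasDerivAt_id z).const_mul μ)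
    simpa using this
  have h1 : HasDerivAt (Q ∘ fun t : ℂ => (t, μ * t)) (fderiv ℂ Q (z, μ * z) (1, μ)) z :=
    HasFDerivAt.comp_hasDerivAt (f := fun t : ℂ => (t, μ * t)) z (hQ (z, μ * z)).hasFDerivAt hι
  have h2 : HasDerivAt (Q ∘ fun t : ℂ => (t, μ * t)) (c * (n * z ^ (n - 1))) z := by
    have : (Q ∘ fun t : ℂ => (t, μ * t)) = fun t => c * t ^ n := funext hline
    rw [this]
    exact (hasDerivAt_pow n z).const_mul c
  exact h1.unique h2

/-- Directional derivative of a differentiable `Q` along the diagonal on which it vanishes.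
[folklore] -/
theorem fderiv_apply_one_one {Q : ℂ × ℂ → ℂ} (hQ : Differentiable ℂ Q)
    (hdiag : ∀ t : ℂ, Q (t, t) = 0) (z : ℂ) : fderiv ℂ Q (z, z) (1, 1) = 0 := by
  have hι : HasDerivAt (fun t : ℂ => (t, t)) (1, 1) z := by
    have := (hasDerivAt_id z).prodMk (hasDerivAt_id z)
    simpa using this
  have h1 : HasDerivAt (Q ∘ fun t : ℂ => (t, t)) (fderiv ℂ Q (z, z) (1, 1)) z :=
    HasFDerivAt.comp_hasDerivAt (f := fun t : ℂ => (t, t)) z (hQ (z, z)).hasFDerivAt hι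
  have h2 : HasDerivAt (Q ∘ fun t : ℂ => (t, t)) 0 z := by
    have : (Q ∘ fun t : ℂ => (t, t)) = fun _ => 0 := funext hdiag
    rw [this]; exact hasDerivAt_const z 0
  exact h1.unique h2

/-! ### The two Jacobian computations -/

/-- **Inner zeros have positive Jacobian.** A complex-linear endomorphism `L` of `ℂ × ℂ` with
`(L (1, μ)).1 = 0`, `(L (0, 1)).1 ≠ 0` and `(L (1, μ)).2 ≠ 0` has `det_ℂ L = -(L (0,1)).1 (L (1,μ)).2
≠ 0`, so its real determinant `|det_ℂ L|²` is positive. [folklore] -/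
theorem det_restrictScalars_pos_of (L : (ℂ × ℂ) →ₗ[ℂ] (ℂ × ℂ)) (μ : ℂ)
    (h1 : (L (1, μ)).1 = 0) (hb : (L (0, 1)).1 ≠ 0) (hβ : (L (1, μ)).2 ≠ 0) :
    0 < LinearMap.det (L.restrictScalars ℝ) := by
  rw [det_restrictScalars_prod, det_prod_self_of_apply_one L μ h1]
  exact normSq_pos.2 (neg_ne_zero.2 (mul_ne_zero hb hβ))

/-- **Diagonal zeros: the Jacobian factors.** A real-linear endomorphism `A` of `ℂ × ℂ` of the
form `A (x, y) = (α (x - y), γ (x - y) - ε D y)` (`α, γ ∈ ℂ`, `ε ∈ ℝ`, `D` real-linear on `ℂ`)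
has `det A = |α|² ε² det D` (shear `(x, y) ↦ (x + y, y)` of determinant one, then a block
lower-triangular matrix). [folklore] -/
theorem det_of_diag_shape (A : (ℂ × ℂ) →ₗ[ℝ] (ℂ × ℂ)) (α γ : ℂ) (ε : ℝ) (D : ℂ →ₗ[ℝ] ℂ)
    (hA : ∀ x y : ℂ, A (x, y) = (α * (x - y), γ * (x - y) - ε • D y)) :
    LinearMap.det A = normSq α * (ε ^ 2 * LinearMap.det D) := by
  set Sh : (ℂ × ℂ) →ₗ[ℝ] (ℂ × ℂ) :=
    (LinearMap.fst ℝ ℂ ℂ + LinearMap.snd ℝ ℂ ℂ).prod (LinearMap.snd ℝ ℂ ℂ) with hSh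
  have hShapp : ∀ x y : ℂ, Sh (x, y) = (x + y, y) := fun x y => rfl
  have hdetSh : LinearMap.det Sh = 1 := by
    rw [det_of_snd_apply_inl_eq_zero Sh (fun x => by simp [hShapp])]
    have e1 : (LinearMap.fst ℝ ℂ ℂ) ∘ₗ Sh ∘ₗ (LinearMap.inl ℝ ℂ ℂ) = LinearMap.id := by
      apply LinearMap.ext; intro x; simp [hShapp]
    have e2 : (LinearMap.snd ℝ ℂ ℂ) ∘ₗ Sh ∘ₗ (LinearMap.inr ℝ ℂ ℂ) = LinearMap.id := by
      apply LinearMap.ext; intro x; simp [hShapp]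
    rw [e1, e2, LinearMap.det_id, mul_one]
  have hASh : ∀ x y : ℂ, (A ∘ₗ Sh) (x, y) = (α * x, γ * x - ε • D y) := by
    intro x y
    simp only [LinearMap.coe_comp, Function.comp_apply, hShapp, hA, add_sub_cancel_right]
  have e1 : (LinearMap.fst ℝ ℂ ℂ) ∘ₗ (A ∘ₗ Sh) ∘ₗ (LinearMap.inl ℝ ℂ ℂ) =
      (LinearMap.mul ℂ ℂ α).restrictScalars ℝ := by
    apply LinearMap.ext; intro x
    simp only [LinearMap.coe_comp, Function.comp_apply, LinearMap.inl_apply, LinearMap.fst_apply,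
      LinearMap.coe_restrictScalars, LinearMap.mul_apply_apply]
    rw [show (A (Sh (x, 0))) = (A ∘ₗ Sh) (x, 0) from rfl, hASh]
  have e2 : (LinearMap.snd ℝ ℂ ℂ) ∘ₗ (A ∘ₗ Sh) ∘ₗ (LinearMap.inr ℝ ℂ ℂ) = (-ε) • D := by
    apply LinearMap.ext; intro y
    simp only [LinearMap.coe_comp, Function.comp_apply, LinearMap.inr_apply, LinearMap.snd_apply,
      LinearMap.smul_apply]
    rw [show (A (Sh (0, y))) = (A ∘ₗ Sh) (0, y) from rfl, hASh]
    simp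
  have hcomp : LinearMap.det (A ∘ₗ Sh) = normSq α * ((-ε) ^ 2 * LinearMap.det D) := by
    rw [det_of_fst_apply_inr_eq_zero (A ∘ₗ Sh) (fun y => by rw [hASh]; simp), e1, e2,
      det_mul_restrictScalars, LinearMap.det_smul, Complex.finrank_real_complex]
  rw [LinearMap.det_comp, hdetSh, mul_one] at hcomp
  rw [hcomp]; ring

/-! ### The model map: zeros, Jacobians, and the signed count -/

/-- **The model map.** For `k ≥ 2`, coefficients `C_μ ≠ 0` and orders `m_μ ≥ k - 1` attached to
the `k`-th roots of unity `μ ≠ 1`, the interpolant `Q` (`Q(z, μz) = -C_μ z^{m_μ}`, `Q(z,z) = 0`),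
a planar field `e₂` equal to `1` on `‖w‖ ≤ a` with an explicit finite zero set `Z₂` of
non-degenerate zeros of Jacobian sign `sign N` in the disc `‖w‖ < s` (`#Z₂ = |N|`), and
`0 < ε` with `ε · sup |e₂| < |C_μ| a^{m_μ}`, the map
`Φ(z, w) = (zᵏ - wᵏ, Q(z, w) - ε e₂(w))` has, in the bidisc `‖(z, w)‖ < s`, exactly the zeros
`(w, w)`, `w ∈ Z₂`, and `(z, μz)` with `z^{m_μ} = -ε / C_μ`; all of them are non-degenerate, the
latter with positive Jacobian (`Φ` is holomorphic there), the former with Jacobian of the sign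
of `N`; hence the signed count of zeros is `Σ_μ m_μ + N`. [folklore] -/
theorem model_package {k : ℕ} (hk : 2 ≤ k) {C : ℂ → ℂ} {m : ℂ → ℕ}
    (hC : ∀ μ ∈ (Polynomial.nthRootsFinset k (1 : ℂ)).erase 1, C μ ≠ 0)
    (hm : ∀ μ ∈ (Polynomial.nthRootsFinset k (1 : ℂ)).erase 1, k - 1 ≤ m μ)
    {Q : ℂ × ℂ → ℂ}
    (hQ : ∀ p, Q p = ∑ μ' ∈ (Polynomial.nthRootsFinset k (1 : ℂ)).erase 1,
      -C μ' * p.1 ^ (m μ' - (k - 1)) *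
        ∏ ν ∈ (Polynomial.nthRootsFinset k (1 : ℂ)).erase μ', (p.2 - ν * p.1) / (μ' - ν))
    {e₂ : ℂ → ℂ} {Z₂ : Finset ℂ} {D₂ : ℂ → ℂ →L[ℝ] ℂ} {a s : ℝ} {N : ℤ}
    (ha : 0 < a) (has : a < s)
    (he1 : ∀ w, ‖w‖ ≤ a → e₂ w = 1) (hZ₂ : ∀ w, ‖w‖ ≤ s → (e₂ w = 0 ↔ w ∈ Z₂))
    (hZ₂s : ∀ w ∈ Z₂, ‖w‖ < s) (hD₂ : ∀ w ∈ Z₂, HasFDerivAt e₂ (D₂ w) w)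
    (hsign : ∀ w ∈ Z₂, 0 < (N : ℝ) * LinearMap.det (D₂ w : ℂ →ₗ[ℝ] ℂ))
    (hcard : Z₂.card = N.natAbs)
    {M ε : ℝ} (hε : 0 < ε) (hM : ∀ w, ‖w‖ ≤ s → ‖e₂ w‖ ≤ M)
    (hsmall : ∀ μ ∈ (Polynomial.nthRootsFinset k (1 : ℂ)).erase 1, ε * M < ‖C μ‖ * a ^ m μ)
    {Φ : ℂ × ℂ → ℂ × ℂ} (hΦ : ∀ p, Φ p = (p.1 ^ k - p.2 ^ k, Q p - ε * e₂ p.2)) :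
    ∃ (Zm : Finset (ℂ × ℂ)) (A : ℂ × ℂ → (ℂ × ℂ →L[ℝ] ℂ × ℂ)),
      (∀ p : ℂ × ℂ, ‖p‖ < s → (Φ p = 0 ↔ p ∈ Zm)) ∧ (∀ p ∈ Zm, ‖p‖ < s) ∧
      (∀ p ∈ Zm, HasFDerivAt Φ (A p) p) ∧
      (∀ p ∈ Zm, LinearMap.det (A p : ℂ × ℂ →ₗ[ℝ] ℂ × ℂ) ≠ 0) ∧
      (∑ p ∈ Zm, (if 0 < LinearMap.det (A p : ℂ × ℂ →ₗ[ℝ] ℂ × ℂ) then (1 : ℤ) else -1)) =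
        (∑ μ ∈ (Polynomial.nthRootsFinset k (1 : ℂ)).erase 1, (m μ : ℤ)) + N := by
  classical
  -- ### roots of unity bookkeeping
  set Rk := Polynomial.nthRootsFinset k (1 : ℂ) with hRk
  set S := Rk.erase 1 with hS
  have hk0 : 0 < k := by omega
  have hSpow : ∀ μ ∈ S, μ ^ k = 1 := fun μ hμ =>
    (Polynomial.mem_nthRootsFinset hk0 (1 : ℂ)).1 (Finset.mem_of_mem_erase hμ)
  have hSne1 : ∀ μ ∈ S, μ ≠ 1 := fun μ hμ => Finset.ne_of_mem_erase hμ
  have hSne0 : ∀ μ ∈ S, μ ≠ 0 := fun μ hμ h0 => by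
    have := hSpow μ hμ; rw [h0, zero_pow hk0.ne'] at this; exact zero_ne_one this
  have hSnorm : ∀ μ ∈ S, ‖μ‖ = 1 := fun μ hμ =>
    Complex.norm_eq_one_of_pow_eq_one (hSpow μ hμ) hk0.ne'
  have hm1 : ∀ μ ∈ S, 0 < m μ := fun μ hμ => lt_of_lt_of_le (by omega) (hm μ hμ)
  -- `M ≥ 1`
  have hM1 : 1 ≤ M := by
    have := hM 0 (by rw [norm_zero]; exact (ha.trans has).le)
    rwa [he1 0 (by rw [norm_zero]; exact ha.le), norm_one] at this
  -- ### the inner roots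
  have hr : ∀ μ, ∃ r : ℂ, 0 < m μ → r ^ m μ = -ε / C μ := fun μ => by
    by_cases h : 0 < m μ
    · obtain ⟨r, hr⟩ := IsAlgClosed.exists_pow_nat_eq (-ε / C μ : ℂ) h
      exact ⟨r, fun _ => hr⟩
    · exact ⟨0, fun h' => absurd h' h⟩
  choose r hr using hr
  have hrS : ∀ μ ∈ S, r μ ^ m μ = -ε / C μ := fun μ hμ => hr μ (hm1 μ hμ)
  have hεC : ∀ μ ∈ S, (-ε / C μ : ℂ) ≠ 0 := fun μ hμ =>
    div_ne_zero (neg_ne_zero.2 (ofReal_ne_zero.2 hε.ne')) (hC μ hμ)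
  have hr0 : ∀ μ ∈ S, r μ ≠ 0 := fun μ hμ h0 => by
    have := hrS μ hμ
    rw [h0, zero_pow (hm1 μ hμ).ne'] at this
    exact hεC μ hμ this.symm
  have hra : ∀ μ ∈ S, ‖r μ‖ < a := by
    intro μ hμ
    have hCpos : 0 < ‖C μ‖ := norm_pos_iff.2 (hC μ hμ)
    have h1 : ‖r μ‖ ^ m μ = ε / ‖C μ‖ := by
      rw [← norm_pow, hrS μ hμ, norm_div, norm_neg, norm_real, Real.norm_of_nonneg hε.le]
    have h2 : ε / ‖C μ‖ < a ^ m μ := by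
      rw [div_lt_iff₀ hCpos]
      have := hsmall μ hμ
      nlinarith [mul_le_mul_of_nonneg_left hM1 hε.le]
    exact lt_of_pow_lt_pow_left₀ (m μ) ha.le (by rw [h1]; exact h2)
  set roots : ℂ → Finset ℂ := fun μ =>
    (Polynomial.nthRootsFinset (m μ) (1 : ℂ)).image fun ζ => r μ * ζ with hroots
  have hmem_roots : ∀ μ ∈ S, ∀ z, z ∈ roots μ ↔ z ^ m μ = -ε / C μ := by
    intro μ hμ z
    rw [← hrS μ hμ, pow_eq_pow_iff_exists_root' (hm1 μ hμ) (hr0 μ hμ)]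
    simp only [hroots, Finset.mem_image]
    constructor
    · rintro ⟨ζ, hζ, rfl⟩; exact ⟨ζ, hζ, rfl⟩
    · rintro ⟨ζ, hζ, rfl⟩; exact ⟨ζ, hζ, rfl⟩
  have hnorm_roots : ∀ μ ∈ S, ∀ z ∈ roots μ, ‖z‖ = ‖r μ‖ := by
    intro μ hμ z hz
    obtain ⟨ζ, hζ, rfl⟩ := Finset.mem_image.1 hz
    rw [norm_mul, Complex.norm_eq_one_of_pow_eq_one
      ((Polynomial.mem_nthRootsFinset (hm1 μ hμ) (1 : ℂ)).1 hζ) (hm1 μ hμ).ne', mul_one]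
  have hcard_roots : ∀ μ ∈ S, (roots μ).card = m μ := by
    intro μ hμ
    simp only [hroots]
    rw [Finset.card_image_of_injective _ (mul_right_injective₀ (hr0 μ hμ)),
      (Complex.isPrimitiveRoot_exp (m μ) (hm1 μ hμ).ne').card_nthRootsFinset]
  have hroots0 : ∀ μ ∈ S, ∀ z ∈ roots μ, z ≠ 0 := fun μ hμ z hz h0 => by
    have := hnorm_roots μ hμ z hz
    rw [h0, norm_zero] at this
    exact hr0 μ hμ (norm_eq_zero.1 this.symm)
  have hrootsa : ∀ μ ∈ S, ∀ z ∈ roots μ, ‖μ * z‖ < a := fun μ hμ z hz => by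
    rw [norm_mul, hSnorm μ hμ, one_mul, hnorm_roots μ hμ z hz]; exact hra μ hμ
  -- ### the zero sets
  set Zin : Finset (ℂ × ℂ) := S.biUnion fun μ => (roots μ).image fun z => (z, μ * z) with hZin
  set Zdiag : Finset (ℂ × ℂ) := Z₂.image fun w => (w, w) with hZdiag
  have hZ₂a : ∀ w ∈ Z₂, a < ‖w‖ := by
    intro w hw
    by_contra h
    have h1 := he1 w (not_lt.1 h)
    have h2 := (hZ₂ w (hZ₂s w hw).le).2 hw
    rw [h2] at h1; exact zero_ne_one h1
  have hZ₂0 : ∀ w ∈ Z₂, w ≠ 0 := fun w hw h0 => by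
    have := hZ₂a w hw; rw [h0, norm_zero] at this; exact lt_irrefl _ (ha.trans this)
  have hnotin : ∀ μ ∈ S, ∀ z ∈ roots μ, μ * z ∉ Z₂ := fun μ hμ z hz h => by
    linarith [hZ₂a _ h, hrootsa μ hμ z hz]
  have hmemZin : ∀ p : ℂ × ℂ, p ∈ Zin ↔ ∃ μ ∈ S, p.1 ∈ roots μ ∧ p.2 = μ * p.1 := by
    intro p
    simp only [hZin, Finset.mem_biUnion, Finset.mem_image]
    constructor
    · rintro ⟨μ, hμ, z, hz, rfl⟩; exact ⟨μ, hμ, hz, rfl⟩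
    · rintro ⟨μ, hμ, hz, h2⟩; exact ⟨μ, hμ, p.1, hz, Prod.ext rfl h2.symm⟩
  have hmemZdiag : ∀ p : ℂ × ℂ, p ∈ Zdiag ↔ p.1 ∈ Z₂ ∧ p.2 = p.1 := by
    intro p
    simp only [hZdiag, Finset.mem_image]
    constructor
    · rintro ⟨w, hw, rfl⟩; exact ⟨hw, rfl⟩
    · rintro ⟨h1, h2⟩; exact ⟨p.1, h1, Prod.ext rfl h2.symm⟩
  have hdisj : Disjoint Zdiag Zin := by
    rw [Finset.disjoint_left]
    intro p hp hp'
    obtain ⟨hw, hpw⟩ := (hmemZdiag p).1 hp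
    obtain ⟨μ, hμ, hz, hpz⟩ := (hmemZin p).1 hp'
    have : μ * p.1 = 1 * p.1 := by rw [← hpz, one_mul, hpw]
    exact hSne1 μ hμ (mul_right_cancel₀ (hZ₂0 _ hw) this)
  -- ### calculus of `Q` and `Φ`
  have hQfun : Q = fun p : ℂ × ℂ => ∑ μ' ∈ Rk.erase 1,
      -C μ' * p.1 ^ (m μ' - (k - 1)) * ∏ ν ∈ Rk.erase μ', (p.2 - ν * p.1) / (μ' - ν) :=
    funext hQ
  have hQd : Differentiable ℂ Q := by rw [hQfun]; exact differentiable_interpolant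
  have hQline : ∀ μ ∈ S, ∀ z, Q (z, μ * z) = -C μ * z ^ m μ := by
    intro μ hμ z; rw [hQ]; exact interpolant_line hk0 hm hμ z
  have hQdiag : ∀ z, Q (z, z) = 0 := fun z => by rw [hQ]; exact interpolant_diag z
  have hΦfun : Φ = fun q : ℂ × ℂ => (q.1 ^ k - q.2 ^ k, Q q - (ε : ℝ) • e₂ q.2) := by
    funext q; rw [hΦ q, real_smul]
  -- the first-component derivative
  set P' : ℂ × ℂ → (ℂ × ℂ →L[ℂ] ℂ) := fun p =>
    ((k : ℂ) * p.1 ^ (k - 1)) • ContinuousLinearMap.fst ℂ ℂ ℂ -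
      ((k : ℂ) * p.2 ^ (k - 1)) • ContinuousLinearMap.snd ℂ ℂ ℂ with hP'
  have hP'app : ∀ p q : ℂ × ℂ, P' p q = (k : ℂ) * p.1 ^ (k - 1) * q.1 - (k : ℂ) * p.2 ^ (k - 1) * q.2 := by
    intro p q
    simp only [hP', sub_apply, smul_apply, ContinuousLinearMap.coe_fst',
      ContinuousLinearMap.coe_snd', smul_eq_mul]
  -- the two derivative formulas
  set Adiag : ℂ → (ℂ × ℂ →L[ℝ] ℂ × ℂ) := fun w =>
    ((P' (w, w)).restrictScalars ℝ).prod
      (((fderiv ℂ Q (w, w)).restrictScalars ℝ) - (ε : ℝ) • (D₂ w).comp (ContinuousLinearMap.snd ℝ ℂ ℂ))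
    with hAdiag
  set Ain : ℂ × ℂ → (ℂ × ℂ →L[ℝ] ℂ × ℂ) := fun p =>
    ((P' p).restrictScalars ℝ).prod ((fderiv ℂ Q p).restrictScalars ℝ) with hAin
  -- ### derivative at the diagonal zeros
  have hderiv_diag : ∀ w ∈ Z₂, HasFDerivAt Φ (Adiag w) (w, w) := by
    intro w hw
    have he : HasFDerivAt (fun q : ℂ × ℂ => (ε : ℝ) • e₂ q.2)
        ((ε : ℝ) • (D₂ w).comp (ContinuousLinearMap.snd ℝ ℂ ℂ)) (w, w) :=
      ((hD₂ w hw).comp (w, w) (hasFDerivAt_snd (𝕜 := ℝ) (E := ℂ))).const_smul ε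
    have h := ((hasFDerivAt_pow_sub_pow k (w, w)).restrictScalars ℝ).prodMk
      (((hQd (w, w)).hasFDerivAt.restrictScalars ℝ).sub he)
    rw [hΦfun]
    exact h
  -- ### derivative at the inner zeros
  have hderiv_in : ∀ μ ∈ S, ∀ z ∈ roots μ, HasFDerivAt Φ (Ain (z, μ * z)) (z, μ * z) := by
    intro μ hμ z hz
    have he : HasFDerivAt (fun q : ℂ × ℂ => (ε : ℝ) • e₂ q.2) (0 : ℂ × ℂ →L[ℝ] ℂ) (z, μ * z) := by
      have hev : ∀ᶠ q : ℂ × ℂ in 𝓝 (z, μ * z), (ε : ℝ) • (1 : ℂ) = (ε : ℝ) • e₂ q.2 := by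
        have hopen : IsOpen {q : ℂ × ℂ | ‖q.2‖ < a} :=
          isOpen_lt (continuous_norm.comp continuous_snd) continuous_const
        filter_upwards [hopen.mem_nhds (show (z, μ * z) ∈ {q : ℂ × ℂ | ‖q.2‖ < a} from
          hrootsa μ hμ z hz)] with q hq
        rw [he1 q.2 (le_of_lt hq)]
      exact (hasFDerivAt_const ((ε : ℝ) • (1 : ℂ)) (z, μ * z)).congr_of_eventuallyEq
        (hev.mono fun q hq => hq.symm)
    have h := ((hasFDerivAt_pow_sub_pow k (z, μ * z)).restrictScalars ℝ).prodMk
      (((hQd (z, μ * z)).hasFDerivAt.restrictScalars ℝ).sub he)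
    rw [sub_zero] at h
    rw [hΦfun]
    exact h
  -- ### Jacobian at the inner zeros: positive
  have hdet_in : ∀ μ ∈ S, ∀ z ∈ roots μ,
      0 < LinearMap.det (Ain (z, μ * z) : ℂ × ℂ →ₗ[ℝ] ℂ × ℂ) := by
    intro μ hμ z hz
    have hz0 : z ≠ 0 := hroots0 μ hμ z hz
    set L : ℂ × ℂ →L[ℂ] ℂ × ℂ := (P' (z, μ * z)).prod (fderiv ℂ Q (z, μ * z)) with hL
    have hAL : (Ain (z, μ * z) : ℂ × ℂ →ₗ[ℝ] ℂ × ℂ) =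
        (L : ℂ × ℂ →ₗ[ℂ] ℂ × ℂ).restrictScalars ℝ := by
      apply LinearMap.ext; intro q; rfl
    rw [hAL]
    have hLapp : ∀ q, (L : ℂ × ℂ →ₗ[ℂ] ℂ × ℂ) q = (P' (z, μ * z) q, fderiv ℂ Q (z, μ * z) q) :=
      fun q => rfl
    refine det_restrictScalars_pos_of _ μ ?_ ?_ ?_
    · rw [hLapp, hP'app]
      simp only [mul_one]
      have hk1 : k - 1 + 1 = k := Nat.sub_add_cancel hk0
      calc (k : ℂ) * z ^ (k - 1) - (k : ℂ) * (μ * z) ^ (k - 1) * μ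
          = (k : ℂ) * z ^ (k - 1) * (1 - μ ^ (k - 1) * μ) := by ring
        _ = 0 := by rw [← pow_succ, hk1, hSpow μ hμ]; ring
    · rw [hLapp, hP'app]
      simp only [mul_zero, zero_sub, mul_one, ne_eq, neg_eq_zero]
      exact mul_ne_zero (Nat.cast_ne_zero.2 hk0.ne') (pow_ne_zero _ (mul_ne_zero (hSne0 μ hμ) hz0))
    · rw [hLapp]
      simp only
      rw [fderiv_apply_one_mu hQd (hQline μ hμ) z]
      exact mul_ne_zero (neg_ne_zero.2 (hC μ hμ))
        (mul_ne_zero (Nat.cast_ne_zero.2 (hm1 μ hμ).ne') (pow_ne_zero _ hz0))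
  -- ### Jacobian at the diagonal zeros: sign of `N`
  have hdet_diag : ∀ w ∈ Z₂,
      LinearMap.det (Adiag w : ℂ × ℂ →ₗ[ℝ] ℂ × ℂ) =
        normSq ((k : ℂ) * w ^ (k - 1)) * (ε ^ 2 * LinearMap.det (D₂ w : ℂ →ₗ[ℝ] ℂ)) := by
    intro w hw
    refine det_of_diag_shape _ ((k : ℂ) * w ^ (k - 1)) (fderiv ℂ Q (w, w) (1, 0)) ε _ ?_
    intro x y
    have hQ' : fderiv ℂ Q (w, w) (x, y) = fderiv ℂ Q (w, w) (1, 0) * (x - y) := by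
      have h1 : ((x, y) : ℂ × ℂ) = (x - y) • ((1, 0) : ℂ × ℂ) + y • ((1, 1) : ℂ × ℂ) := by
        ext <;> simp
      rw [h1, map_add, map_smul, map_smul, fderiv_apply_one_one hQd hQdiag w, smul_zero, add_zero,
        smul_eq_mul, mul_comm]
    change (P' (w, w) (x, y), fderiv ℂ Q (w, w) (x, y) - (ε : ℝ) • D₂ w y) = _
    rw [hP'app, hQ']
    ext
    · simp only; ring
    · rfl
  have hdet_diag_sign : ∀ w ∈ Z₂,
      (0 < LinearMap.det (Adiag w : ℂ × ℂ →ₗ[ℝ] ℂ × ℂ) ↔ 0 < N) ∧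
        LinearMap.det (Adiag w : ℂ × ℂ →ₗ[ℝ] ℂ × ℂ) ≠ 0 := by
    intro w hw
    rw [hdet_diag w hw]
    have hw0 := hZ₂0 w hw
    have hαpos : 0 < normSq ((k : ℂ) * w ^ (k - 1)) :=
      normSq_pos.2 (mul_ne_zero (Nat.cast_ne_zero.2 hk0.ne') (pow_ne_zero _ hw0))
    have hs := hsign w hw
    have hε2 : 0 < ε ^ 2 := by positivity
    have hD0 : LinearMap.det (D₂ w : ℂ →ₗ[ℝ] ℂ) ≠ 0 := fun h => by
      rw [h, mul_zero] at hs; exact lt_irrefl _ hs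
    refine ⟨⟨fun h => ?_, fun hN => ?_⟩, mul_ne_zero hαpos.ne' (mul_ne_zero hε2.ne' hD0)⟩
    · have h1 : 0 < LinearMap.det (D₂ w : ℂ →ₗ[ℝ] ℂ) :=
        (pos_iff_pos_of_mul_pos ((pos_iff_pos_of_mul_pos h).1 hαpos)).1 hε2
      have : (0 : ℝ) < N := (pos_iff_pos_of_mul_pos hs).2 h1
      exact_mod_cast this
    · have hN' : (0 : ℝ) < N := by exact_mod_cast hN
      have h1 : 0 < LinearMap.det (D₂ w : ℂ →ₗ[ℝ] ℂ) := (pos_iff_pos_of_mul_pos hs).1 hN'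
      positivity
  -- ### assemble
  refine ⟨Zdiag ∪ Zin, fun p => if p.2 ∈ Z₂ then Adiag p.2 else Ain p, ?_, ?_, ?_, ?_, ?_⟩
  · -- the zero set in the open bidisc
    intro p hp
    have hp1 : ‖p.1‖ < s := (norm_fst_le p).trans_lt hp
    rw [Finset.mem_union, hmemZdiag, hmemZin, hΦ p, Prod.mk_eq_zero, sub_eq_zero, sub_eq_zero]
    constructor
    · rintro ⟨hpow, hQe⟩
      -- `p.1 ≠ 0`
      have hp10 : p.1 ≠ 0 := by
        intro h0
        have h20 : p.2 = 0 := by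
          rw [h0, zero_pow hk0.ne'] at hpow
          exact (pow_eq_zero_iff hk0.ne').1 hpow.symm
        have hQ0 : Q p = 0 := by
          have : p = (0, 0) := Prod.ext h0 h20
          rw [this]; exact hQdiag 0
        rw [hQ0, h20, he1 0 (by rw [norm_zero]; exact ha.le), mul_one] at hQe
        exact (ofReal_ne_zero.2 hε.ne') hQe.symm
      -- `p.2 = μ p.1` for a root of unity `μ`
      set μ := p.2 / p.1 with hμ
      have hμR : μ ∈ Rk := by
        refine (Polynomial.mem_nthRootsFinset hk0 (1 : ℂ)).2 ?_
        rw [hμ, div_pow, ← hpow, div_self (pow_ne_zero _ hp10)]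
      have hp2μ : p.2 = μ * p.1 := by rw [hμ]; field_simp
      by_cases hμ1 : μ = 1
      · -- diagonal
        left
        rw [hμ1, one_mul] at hp2μ
        refine ⟨?_, hp2μ⟩
        have hQ0 : Q p = 0 := by
          have : p = (p.1, p.1) := Prod.ext rfl hp2μ
          rw [this]; exact hQdiag p.1
        rw [hQ0, hp2μ, eq_comm, mul_eq_zero] at hQe
        rcases hQe with h | h
        · exact absurd h (ofReal_ne_zero.2 hε.ne')
        · exact (hZ₂ p.1 hp1.le).1 h
      · -- inner
        right
        have hμS : μ ∈ S := Finset.mem_erase.2 ⟨hμ1, hμR⟩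
        refine ⟨μ, hμS, ?_, hp2μ⟩
        have hQp : Q p = -C μ * p.1 ^ m μ := by
          have : p = (p.1, μ * p.1) := Prod.ext rfl hp2μ
          rw [this]; exact hQline μ hμS p.1
        rw [hQp, hp2μ] at hQe
        -- `‖p.1‖ < a`, for otherwise the two sides have different sizes
        have hsmallp : ‖p.1‖ < a := by
          by_contra hge
          push Not at hge
          have h1 : ‖C μ‖ * a ^ m μ ≤ ‖-C μ * p.1 ^ m μ‖ := by
            rw [norm_mul, norm_neg, norm_pow]
            exact mul_le_mul_of_nonneg_left (pow_le_pow_left₀ ha.le hge _) (norm_nonneg _)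
          have h2 : ‖(ε : ℂ) * e₂ (μ * p.1)‖ ≤ ε * M := by
            rw [norm_mul, norm_real, Real.norm_of_nonneg hε.le]
            refine mul_le_mul_of_nonneg_left (hM _ ?_) hε.le
            rw [norm_mul, hSnorm μ hμS, one_mul]; exact hp1.le
          rw [hQe] at h1
          linarith [hsmall μ hμS]
        have he : e₂ (μ * p.1) = 1 :=
          he1 _ (by rw [norm_mul, hSnorm μ hμS, one_mul]; exact hsmallp.le)
        rw [he, mul_one] at hQe
        rw [hmem_roots μ hμS]
        have hC0 := hC μ hμS
        field_simp
        linear_combination (-1 : ℂ) * hQe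
    · rintro (⟨hw, hpw⟩ | ⟨μ, hμ, hz, hpz⟩)
      · refine ⟨by rw [hpw], ?_⟩
        have : p = (p.1, p.1) := Prod.ext rfl hpw
        rw [this, hQdiag, (hZ₂ p.1 hp1.le).2 hw]; simp
      · refine ⟨?_, ?_⟩
        · rw [hpz, mul_pow, hSpow μ hμ, one_mul]
        · have : p = (p.1, μ * p.1) := Prod.ext rfl hpz
          rw [this, hQline μ hμ]
          simp only
          rw [he1 _ (hrootsa μ hμ _ hz).le, mul_one, (hmem_roots μ hμ p.1).1 hz]
          have hC0 := hC μ hμ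
          field_simp
  · -- the zeros lie in the open bidisc
    intro p hp
    rcases Finset.mem_union.1 hp with hp | hp
    · obtain ⟨hw, hpw⟩ := (hmemZdiag p).1 hp
      have h1 : ‖p.1‖ < s := hZ₂s _ hw
      calc ‖p‖ = max ‖p.1‖ ‖p.2‖ := rfl
        _ < s := by rw [hpw, max_self]; exact h1
    · obtain ⟨μ, hμ, hz, hpz⟩ := (hmemZin p).1 hp
      have h1 : ‖p.1‖ < s := by rw [hnorm_roots μ hμ _ hz]; exact (hra μ hμ).trans has
      have h2 : ‖p.2‖ < s := by rw [hpz]; exact (hrootsa μ hμ _ hz).trans has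
      calc ‖p‖ = max ‖p.1‖ ‖p.2‖ := rfl
        _ < s := max_lt h1 h2
  · -- derivatives
    intro p hp
    rcases Finset.mem_union.1 hp with hp | hp
    · obtain ⟨hw, hpw⟩ := (hmemZdiag p).1 hp
      have hp2 : p.2 ∈ Z₂ := by rw [hpw]; exact hw
      change HasFDerivAt Φ (if p.2 ∈ Z₂ then Adiag p.2 else Ain p) p
      rw [if_pos hp2]
      have : p = (p.2, p.2) := Prod.ext hpw.symm rfl
      rw [this]; exact hderiv_diag p.2 hp2
    · obtain ⟨μ, hμ, hz, hpz⟩ := (hmemZin p).1 hp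
      have hp2 : p.2 ∉ Z₂ := by rw [hpz]; exact hnotin μ hμ _ hz
      change HasFDerivAt Φ (if p.2 ∈ Z₂ then Adiag p.2 else Ain p) p
      rw [if_neg hp2]
      have : p = (p.1, μ * p.1) := Prod.ext rfl hpz
      rw [this]; exact hderiv_in μ hμ p.1 hz
  · -- non-degeneracy
    intro p hp
    rcases Finset.mem_union.1 hp with hp | hp
    · obtain ⟨hw, hpw⟩ := (hmemZdiag p).1 hp
      have hp2 : p.2 ∈ Z₂ := by rw [hpw]; exact hw
      change LinearMap.det ((if p.2 ∈ Z₂ then Adiag p.2 else Ain p : ℂ × ℂ →L[ℝ] ℂ × ℂ) :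
        ℂ × ℂ →ₗ[ℝ] ℂ × ℂ) ≠ 0
      rw [if_pos hp2]
      exact (hdet_diag_sign p.2 hp2).2
    · obtain ⟨μ, hμ, hz, hpz⟩ := (hmemZin p).1 hp
      have hp2 : p.2 ∉ Z₂ := by rw [hpz]; exact hnotin μ hμ _ hz
      change LinearMap.det ((if p.2 ∈ Z₂ then Adiag p.2 else Ain p : ℂ × ℂ →L[ℝ] ℂ × ℂ) :
        ℂ × ℂ →ₗ[ℝ] ℂ × ℂ) ≠ 0
      rw [if_neg hp2]
      have : p = (p.1, μ * p.1) := Prod.ext rfl hpz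
      rw [this]; exact (hdet_in μ hμ p.1 hz).ne'
  · -- the signed count
    rw [Finset.sum_union hdisj, add_comm]
    congr 1
    · -- inner zeros: `+1` each
      rw [hZin, Finset.sum_biUnion]
      · refine Finset.sum_congr rfl fun μ hμ => ?_
        rw [Finset.sum_image fun z _ z' _ h => (Prod.mk.inj h).1]
        have hterm : ∀ z ∈ roots μ, (if 0 < LinearMap.det
            (((fun p : ℂ × ℂ => if p.2 ∈ Z₂ then Adiag p.2 else Ain p) (z, μ * z) :
              ℂ × ℂ →L[ℝ] ℂ × ℂ) : ℂ × ℂ →ₗ[ℝ] ℂ × ℂ) then (1 : ℤ) else -1) = 1 := by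
          intro z hz
          have hA : (fun p : ℂ × ℂ => if p.2 ∈ Z₂ then Adiag p.2 else Ain p) (z, μ * z) =
              Ain (z, μ * z) := by
            change (if μ * z ∈ Z₂ then Adiag (μ * z) else Ain (z, μ * z)) = Ain (z, μ * z)
            rw [if_neg (hnotin μ hμ z hz)]
          rw [hA, if_pos (hdet_in μ hμ z hz)]
        rw [Finset.sum_congr rfl hterm, Finset.sum_const, hcard_roots μ hμ]
        simp
      · -- pairwise disjointness of the branches
        intro μ hμ μ' hμ' hne
        simp only [Function.onFun]
        rw [Finset.disjoint_left]
        intro p hp hp'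
        obtain ⟨z, hz, rfl⟩ := Finset.mem_image.1 hp
        obtain ⟨z', _, h⟩ := Finset.mem_image.1 hp'
        obtain ⟨h1, h2⟩ := Prod.mk.inj h
        rw [h1] at h2
        exact hne (mul_right_cancel₀ (hroots0 μ hμ z hz) h2).symm
    · -- diagonal zeros: `sign N` each
      rw [hZdiag, Finset.sum_image fun w _ w' _ h => (Prod.mk.inj h).1]
      have hterm : ∀ w ∈ Z₂, (if 0 < LinearMap.det
          (((fun p : ℂ × ℂ => if p.2 ∈ Z₂ then Adiag p.2 else Ain p) (w, w) :
            ℂ × ℂ →L[ℝ] ℂ × ℂ) : ℂ × ℂ →ₗ[ℝ] ℂ × ℂ) then (1 : ℤ) else -1) = N.sign := by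
        intro w hw
        have hA : (fun p : ℂ × ℂ => if p.2 ∈ Z₂ then Adiag p.2 else Ain p) (w, w) = Adiag w := by
          change (if w ∈ Z₂ then Adiag w else Ain (w, w)) = Adiag w
          rw [if_pos hw]
        rw [hA, if_congr (hdet_diag_sign w hw).1 rfl rfl]
        rcases lt_trichotomy N 0 with h | h | h
        · rw [if_neg (not_lt.2 h.le), Int.sign_eq_neg_one_of_neg h]
        · exfalso
          have := hsign w hw
          rw [h, Int.cast_zero, zero_mul] at this
          exact lt_irrefl _ this
        · rw [if_pos h, Int.sign_eq_one_of_pos h]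
      rw [Finset.sum_congr rfl hterm, Finset.sum_const, hcard, nsmul_eq_mul, mul_comm]
      exact_mod_cast Int.sign_mul_natAbs N

end CuspDoublePoints

end Literature.Geometry.Symplectic
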